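import Mathlib
import Literature.NumberTheory.LFunctions.PlateauMollifier
import Literature.MathematicalPhysics.QuantumFieldTheory.Balaban1983to89.B1GaussNorm331
import Literature.MathematicalPhysics.QuantumFieldTheory.Balaban1983to89.B2StepK

/-!
# `Balaban1983to89.B2Sect2BDensities` — T. Bałaban, *(Higgs)₂,₃ quantum fields in a finite volume. II. An upper bound*,
Commun. Math. Phys. **86** (1982) 555–594 [Balaban1982Higgs2], Sect. 2.B «Inductive description of the action after k
steps» pp. 566–569: the DEFINING displays (2.47)–(2.52) of the densities ρ^{(k),L^kε}, ρ′^{(k),L^kε}, ρ″^{(k),L^k}, the whole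
external field Ã^ε (2.51) with the local form «Ã» of (2.45), and the Gaussian factors Z^{(j),L^jε}_{Λ₅^{(j)}} (2.52) — TYPED WITH
BODIES in schematic (matrix) coordinates, their k = 1 instances (2.41)/(2.42) p. 566, and the elementary algebra the
text asserts about them PROVED; plus an EXISTENCE WITNESS for the cut-off ζ^{(k)} of (2.44) (`B2StepK.IsCutoff244`)

statement-level skeleton of published theorems with citation tags; proofs where landed; nothing here is a claim about the Yang–Mills mass gap

PDF held: `paper:balaban1982-cmp86-higgs23-ii` (journal page = PDF page + 554); pp. 565–569 READ AS IMAGES on the ×2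
renders `run/shared/lean/pub/pub-balaban/b2b-balaban-ref1/pages/1982-cmp86-higgs23-II/1982-cmp86-higgs23-II-p011-x2.png`
… `-p015-x2.png`.  Unit `lit-balaban-r14` gen 4 (reader/typer of B1–B2, second reader of B2; B2 fold owner = r02),
HOME `run/shared/lean/pub/lit-balaban/`.

SKELETON rows served.  **B2.Eq2.44** ((2.44)–(2.52), pp. 566–569; before this file: (2.44) typed `B2StepK.bg244` /
`IsCutoff244`, (2.45)–(2.52) `absent (D-rows)`): members (2.45)-Ã, (2.47), (2.48), (2.49), (2.50), (2.51), (2.52) typed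
here (bodies) with the kernel algebra proved; the two conditional-integral displays (2.45)/(2.46) THEMSELVES (p. 567,
twenty-odd printed terms over the multi-scale region system Λ_i^{(j)}) are NOT typed here and stay `absent`.
**B2.Eq2.42** ((2.20)–(2.42); members (2.41)/(2.42) p. 566 before: `absent`): (2.41)/(2.42) are the k = 1 instances of
(2.49)/(2.50) (*"The density ρ^{(k),L^kε} is defined inductively by the formulas generalizing (2.34)–(2.42)"*, p. 567) —
`eq241`, `local242_iff`.

THE SOURCE TEXT, verbatim.  p. 568 [PDF 14]: *"This representation is changed further in a way generalizing
(2.36)–(2.40). The aim is to get a representation proportional to the basic Gaussian density after k renormalization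
transformations, i.e  exp[−½⟨A, Δ^{(k),L^kε}A⟩ − ½⟨φ, Δ^{(k),L^kε}(B^{k−1}(Λ₂^{(k−1)}), A^{(k),ε})φ⟩],  if the fields A, φ
are restricted to the domain Λ₆^{(k−1)′}. We use Proposition I.2.1 and restrictions on the fields, and we estimate
unnecessary terms by O((L^{k−1}ε)^κ)|Λ₆^{(k−1)}| with κ > d. More exactly, we have
½⟨φ, Δ^{(k),L^kε}_{Λ₅^{(k−1)}}(B^{k−1}(Λ₂^{(k−1)}), A^{(k),ε})φ⟩
 = ½⟨Λ₆^{(k−1)′c}φ, Δ^{(k),L^kε}_{Λ₅^{(k−1)}}(B^{k−1}(Λ₂^{(k−1)} ∩ Λ₇^{(k−1)c}), A^{(k),ε})Λ₆^{(k−1)′c}φ⟩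
 + ⟨Λ₆^{(k−1)′c}φ, Δ^{(k),L^kε}_{Λ₅^{(k−1)}}(B^{k−1}(Λ₂^{(k−1)} ∩ Λ₇^{(k−1)c}), A^{(k),ε})(Λ₆^{(k−1)′} ∩ Λ₇^{(k−1)′c})φ⟩
 + ½⟨Λ₆^{(k−1)′}φ, Δ^{(k),L^kε}(B^{k−1}(Λ₂^{(k−1)}), A^{(k),ε})Λ₆^{(k−1)′}φ⟩ + O((L^{k−1}ε)^κ)|Λ₆^{(k−1)}|,  (2.47)
and similarly for the form ⟨A, Δ^{(k),L^kε}_{Λ₅^{(k−1)}}A⟩, except that Neumann boundary conditions are not introduced.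
(…) This way we get a density which we define as ρ^{(k),L^kε}(Λ₀^{(0)},…,Λ₀^{(k−1)}, A, A^{(k),ε}, φ). It has the
following property:
ρ″^{(k),L^k}(Λ₀^{(0)},…,Λ₀^{(k−1)}, A, θ_kA^{(k),ε}, φ) = ρ^{(k),L^kε}(Λ₀^{(0)},…,Λ₀^{(k−1)}, A, θ_kA^{(k),ε}, φ)
 ·exp(O((L^{k−1}ε)^κ)|Λ₅^{(k−1)}|),  (2.48)
and if we define a density ρ′^{(k),L^kε} by the equality
ρ^{(k),L^kε}(Λ₀^{(0)},…,Λ₀^{(k−1)}, A, θ_kA^{(k),ε}, φ) = ρ′^{(k),L^kε}(Λ₀^{(0)},…,Λ₀^{(k−1)}, A, θ_kA^{(k),ε}, φ)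
 ·exp[−½⟨Λ₆^{(k−1)′}A, Δ^{(k),L^kε}Λ₆^{(k−1)′}A⟩ − ½⟨Λ₆^{(k−1)′}φ, Δ^{(k),L^kε}(B^k(Λ₂^{(k−1)′}), A^{(k),ε})Λ₆^{(k−1)′}φ⟩],  (2.49)
then we have
ρ′^{(k),L^kε}(Λ₀^{(0)},…,Λ₀^{(k−1)}, A, θ_kA^{(k),ε}, φ) = ρ′^{(k),L^kε}(Λ₀^{(0)},…,Λ₀^{(k−1)}, Λ₇^{(k−1)′c}A, θ_kA^{(k),ε},
Λ₇^{(k−1)′c}φ).  (2.50)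
Here we treat θ_kA^{(k)} as an independent field configuration appearing only as an external vector field in the
expressions with scalar fields."*  p. 569 [PDF 15]: *"let us write a formula for a whole external vector field in its
scalar field part:  Ã^ε = (1 − θ₁)A₀ + Σ_{j=1}^{k−1}(1 − θ_{j+1})θ_jA^{(j),ε} + θ_kA^{(k),ε},  (2.51)  where A^{(j),ε} is
defined by the formula (2.44) with j and A_j instead of k and A. Obviously we have B^{k−2}(Λ₂^{(k−2)})Ã^ε = Ã′ [we write
here A_{k−1} = A′, φ_{k−1} = φ′ in (2.45), (2.46)]. Also let us write a formula for the Z^{(j)}-factors. (…) We have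
Z^{(j),L^jε}_{Λ₅^{(j)}}(B^j(Λ₂^{(j)}), Ã^ε) = (a(L^{j+1}ε)^{d−2}/2π)^{(N/2)|Λ₅^{(j)}|} ∫dφ↾_{Λ₅^{(j)}} exp(−½⟨φ,
(C^{(j),L^jε}_{Λ₅^{(j)}}(B^j(Λ₂^{(j)}), Ã^ε))^{−1}φ⟩)  (2.52)  for j = 0, 1, …, k − 1."*  p. 567 [PDF 13], after (2.45):
*"where Ã = (1 − θ_k)θ_{k−1}A^{(k−1),ε} + θ_kA^{(k),ε}"*; p. 567 top: *"The function θ_k is defined on T_η, is equal to 1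
on B^{k−1}(Λ₂^{(k−1)}) and varies “smoothly” from 1 to 0 on a slice of thickness < M surrounding B^{k−1}(Λ₂^{(k−1)})."*
p. 566 [PDF 12]: *"ρ^{(1),L}(Λ₀, B, θ₁B^{(1)}, ψ) = ρ′^{(1),L}(Λ₀, B, θ₁B^{(1)}, ψ)·exp[−½⟨Λ′₆B, Δ^{(1),L}Λ′₆B⟩ − ½⟨Λ′₆ψ,
Δ^{(1),L}(Λ₂, B^{(1)})Λ′₆ψ⟩],  (2.41)  ρ′^{(1),L}(Λ₀, B, θ₁B^{(1)}, ψ) = ρ′^{(1),L}(Λ₀, Λ′₇ᶜB, θ₁B^{(1)}, Λ′₇ᶜψ),  (2.42)"*.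
p. 565 [PDF 11]: *"The integrals in the last line of (2.34), after proper rescaling and multiplication by
(a(Lε)^{d−2}/2π)^{(d/2)|Λ₅|}, (a(Lε)^{d−2}/2π)^{(N/2)|Λ₅|}, are equal to the factors Z^{(0),ε}, Z^{(0),ε}(B^{(1)}) calculated on
the set Λ₅ instead of T_ε. We will denote them by Z^{(0),ε}_{Λ₅}, Z^{(0),ε}_{Λ₅}(B^{(1)})."*

DICTIONARY (schematic coordinates, the style of `B1GaussNorm331`, `B2Eq218Translation`, `B2Sect3AGaussianStep`).
`X` ↤ the finitely many real components of the vector field `A` on the lattice in question, `P` ↤ those of the scalar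
field `φ` (points × N components); `Density X P` = `(X → ℝ) → (P → ℝ) → ℝ` ↤ a density as a function of (A, φ), the
regions Λ₀^{(0)},…,Λ₀^{(k−1)} and the external field θ_kA^{(k),ε} being PARAMETERS (p. 568: *"θ_kA^{(k)} … an independent
field configuration"*); a characteristic function `Λ·` of a region ↤ `Set.indicator` of the corresponding set of
components (`S6` ↤ Λ₆^{(k−1)′}, `S7c` ↤ Λ₇^{(k−1)′c}, and their φ-versions `S6'`, `S7c'`); `ΔA : Matrix X X ℝ` ↤
Δ^{(k),L^kε}, `Δφ : Matrix P P ℝ` ↤ Δ^{(k),L^kε}(B^k(Λ₂^{(k−1)′}), A^{(k),ε}) (the quadratic forms `⟨v, Δv⟩ = v ⬝ᵥ Δ *ᵥ v`,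
lattice weights inside the matrix); in (2.47) `Δ`, `Δ'`, `Δ''` ↤ the three printed operators (with region
`B^{k−1}(Λ₂)` localized in Λ₅; with `B^{k−1}(Λ₂ ∩ Λ₇ᶜ)` localized in Λ₅; with `B^{k−1}(Λ₂)` un-localized) and `S7c'` ↤
Λ₇^{(k−1)′c}; `ℓ` ↤ L^{k−1}ε, `κ` ↤ κ > d, `vol6`/`vol5` ↤ |Λ₆^{(k−1)}|, |Λ₅^{(k−1)}|, `C` ↤ the O(1) constant; in (2.51)
`θ : ℕ → X → ℝ` ↤ (θ_j)_j (θ₀ unused), `A₀ : X → M` ↤ A₀, `A : ℕ → X → M` ↤ (A^{(j),ε})_j, values in any real vector space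
`M` (↤ ℝ^d at a point); in (2.52) `T` ↤ the sites of Λ₅^{(j)}, `a`, `ℓ'` ↤ a, L^{j+1}ε, `Cinv` ↤ the matrix of
⟨·,(C^{(j),L^jε}_{Λ₅^{(j)}}(…))⁻¹·⟩ on the N|Λ₅^{(j)}| variables — (2.52) IS part I's (3.32) `B1GaussNorm331.ZkA` on the set Λ₅^{(j)}
with base a(L^{j+1}ε)^{d−2} (REUSED by name, not restated).

WHAT IS PROVED (kernel, no `sorry`, axioms standard).  `half_quadForm_split`/`eq247_exact` (the exact three-term
split behind (2.47) for a symmetric Δ: ½⟨φ,Δφ⟩ = ½⟨Λ₆′ᶜφ,ΔΛ₆′ᶜφ⟩ + ⟨Λ₆′ᶜφ,ΔΛ₆′φ⟩ + ½⟨Λ₆′φ,ΔΛ₆′φ⟩), `eq247_of_replacements`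
((2.47) follows once the three printed replacements — operator localization in terms 1–2, the mask Λ₆′ ↦ Λ₆′ ∩ Λ₇′ᶜ in
term 2, de-localization in term 3 — are each bounded; these bounds are the analytic input *"Proposition I.2.1 and
restrictions on the fields"*, displayed as hypotheses), `Eq248.upper/lower/trans/mul` (the two-sided reading of
«= ρ·exp(O(ℓ^κ)|Λ₅|)» and its bookkeeping), `eq249`/`rhoPrime249_rho249` ((2.49) read either way is an exact
factorization, the Gaussian factor being > 0), `Local250.eq_of_eqOn`/`local250_comp`/`Local250.mul`/`local250_iff`
((2.50): ρ′ depends on A, φ only through Λ₇′ᶜA, Λ₇′ᶜφ), `coeffSum251_eq_one` (under the nesting θ_{j+1}θ_j = θ_{j+1}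
the coefficients of (2.51) sum to 1), `aTilde251_succ(_of_nested)` (one-step recursion of (2.51)),
`aTilde251_eq_aTilde245` (the p. 569 sentence «Obviously B^{k−2}(Λ₂^{(k−2)})Ã^ε = Ã′»: where θ_{k−1} = 1, (2.51) IS the
local two-term form «Ã = (1−θ_k)θ_{k−1}A^{(k−1),ε} + θ_kA^{(k),ε}» of (2.45)), `Z252_eq`/`Z252_pos` ((2.52) in closed form
(a(L^{j+1}ε)^{d−2})^{(N/2)|Λ₅^{(j)}|}/√det Cinv), `zetaClamp_isCutoff244` (the three printed requirements on ζ^{(k)} of (2.44)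
are simultaneously satisfiable as soon as r(L^kε) ≥ 4M + 2, on any lattice whose distance to the block centre moves by
at most η along an η-bond: the clamp max(0, min(1, r − 2M − |x − y|)) is a witness; the 1-Lipschitz property of the
clamp is the tree's `Literature.NumberTheory.LFunctions.PlateauMollifier.abs_clamp_sub_clamp_le`, imported BY NAME).
NOT HERE (honest scope): the displays (2.45)/(2.46) and (2.53); the analytic estimates behind the O-terms of
(2.47)/(2.48) (Proposition I.2.1 = `B1.Prop21Printed`, and (2.109) `B2StepK.KernelBound2109`); the sentence «ρ′ depends
on B^k(Λ₇^{(k−1)′})A^{(k),ε} through the factors Z^{(j)} only» (p. 568) is recorded in the docstring of `Z252`, not typed.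
-/

open scoped BigOperators Matrix
open Finset

namespace Literature.MathematicalPhysics.QuantumFieldTheory.Balaban1983to89.B2Sect2BDensities

/-! ## §1 (2.47) p. 568: splitting the basic quadratic form at Λ₆^{(k−1)′} -/

section Split

variable {X : Type*} [Fintype X]

/-- The algebra behind (2.47) p. 568: for a SYMMETRIC operator Δ and any decomposition φ = u + v,
`½⟨φ,Δφ⟩ = ½⟨u,Δu⟩ + ⟨u,Δv⟩ + ½⟨v,Δv⟩` (the two cross terms coincide by symmetry — this is why (2.47) carries the middle
term without the factor ½). KERNEL. [cite: Balaban1982Higgs2, (2.47) p.568] -/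
theorem half_quadForm_split (Δ : Matrix X X ℝ) (hΔ : Δ.IsSymm) (u v : X → ℝ) :
    (1 / 2 : ℝ) * ((u + v) ⬝ᵥ Δ *ᵥ (u + v)) =
      (1 / 2 : ℝ) * (u ⬝ᵥ Δ *ᵥ u) + u ⬝ᵥ Δ *ᵥ v + (1 / 2 : ℝ) * (v ⬝ᵥ Δ *ᵥ v) := by
  have hsym : v ⬝ᵥ Δ *ᵥ u = u ⬝ᵥ Δ *ᵥ v := by
    rw [Matrix.dotProduct_mulVec u Δ v, ← Matrix.mulVec_transpose, hΔ.eq, dotProduct_comm (Δ *ᵥ u) v]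
  rw [Matrix.mulVec_add, add_dotProduct, dotProduct_add, dotProduct_add, hsym]
  ring

/-- **(2.47) p. 568, its exact skeleton**: with `u = Λ₆^{(k−1)′c}φ` and `v = Λ₆^{(k−1)′}φ` (complementary characteristic
functions, `S6` ↤ the components in Λ₆^{(k−1)′}), for ONE symmetric operator Δ:
`½⟨φ,Δφ⟩ = ½⟨Λ₆′ᶜφ, ΔΛ₆′ᶜφ⟩ + ⟨Λ₆′ᶜφ, ΔΛ₆′φ⟩ + ½⟨Λ₆′φ, ΔΛ₆′φ⟩` — no error term. The printed (2.47) then REPLACES the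
operator/masks term by term (see `eq247_of_replacements`). KERNEL. [cite: Balaban1982Higgs2, (2.47) p.568] -/
theorem eq247_exact (Δ : Matrix X X ℝ) (hΔ : Δ.IsSymm) (S6 : Set X) (φ : X → ℝ) :
    (1 / 2 : ℝ) * (φ ⬝ᵥ Δ *ᵥ φ) =
      (1 / 2 : ℝ) * (S6ᶜ.indicator φ ⬝ᵥ Δ *ᵥ S6ᶜ.indicator φ)
        + S6ᶜ.indicator φ ⬝ᵥ Δ *ᵥ S6.indicator φ
        + (1 / 2 : ℝ) * (S6.indicator φ ⬝ᵥ Δ *ᵥ S6.indicator φ) := by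
  have hφ : S6ᶜ.indicator φ + S6.indicator φ = φ := by
    rw [add_comm]; exact Set.indicator_self_add_compl S6 φ
  rw [← half_quadForm_split Δ hΔ, hφ]

/-- **(2.47)** p. 568 TYPED as the printed estimate: the basic form `total` ↤ ½⟨φ, Δ^{(k),L^kε}_{Λ₅^{(k−1)}}(B^{k−1}(Λ₂^{(k−1)}),
A^{(k),ε})φ⟩ differs from the sum of the three printed terms `t1` ↤ ½⟨Λ₆′ᶜφ, Δ_{Λ₅}(B^{k−1}(Λ₂ ∩ Λ₇ᶜ),·)Λ₆′ᶜφ⟩, `t2` ↤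
⟨Λ₆′ᶜφ, Δ_{Λ₅}(B^{k−1}(Λ₂ ∩ Λ₇ᶜ),·)(Λ₆′ ∩ Λ₇′ᶜ)φ⟩, `t3` ↤ ½⟨Λ₆′φ, Δ(B^{k−1}(Λ₂),·)Λ₆′φ⟩ by *"O((L^{k−1}ε)^κ)|Λ₆^{(k−1)}|"*:
`|total − (t1 + t2 + t3)| ≤ C·ℓ^κ·vol6` (`ℓ` ↤ L^{k−1}ε, `vol6` ↤ |Λ₆^{(k−1)}|, `C` ↤ the O(1) constant, `κ` ↤ κ > d).
READING NOTE: the third printed operator reads «Δ^{(k),L^kε}(B^{k−1}(Λ₂^{(k−1)}(Λ₂^{(k−1)})), A^{(k),ε})» on the page (a doubled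
«(Λ₂^{(k−1)}», no Λ₅-subscript) — read as Δ^{(k),L^kε}(B^{k−1}(Λ₂^{(k−1)})), A^{(k),ε}). [cite: Balaban1982Higgs2, (2.47) p.568] -/
def Eq247 (C ℓ κ vol6 total t1 t2 t3 : ℝ) : Prop :=
  |total - (t1 + t2 + t3)| ≤ C * ℓ ^ κ * vol6

/-- **(2.47) from its three replacements** (the structure of the printed argument *"We use Proposition I.2.1 and
restrictions on the fields, and we estimate unnecessary terms by O((L^{k−1}ε)^κ)|Λ₆^{(k−1)}|"*): starting from the exact
split (`eq247_exact`) for the symmetric operator `Δ` ↤ Δ^{(k),L^kε}_{Λ₅}(B^{k−1}(Λ₂),·), if (i) replacing Δ by `Δ'` ↤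
Δ_{Λ₅}(B^{k−1}(Λ₂ ∩ Λ₇ᶜ),·) in the first term costs ≤ e₁, (ii) replacing Δ by Δ′ and the mask Λ₆′ by Λ₆′ ∩ Λ₇′ᶜ (`S7c` ↤
Λ₇^{(k−1)′c}) in the cross term costs ≤ e₂, (iii) replacing Δ by `Δ''` ↤ Δ(B^{k−1}(Λ₂),·) in the third term costs ≤ e₃, and
e₁ + e₂ + e₃ ≤ C·ℓ^κ·vol6, then (2.47) holds. KERNEL (triangle inequality). [cite: Balaban1982Higgs2, (2.47) p.568] -/
theorem eq247_of_replacements {Δ Δ' Δ'' : Matrix X X ℝ} (hΔ : Δ.IsSymm) (S6 S7c : Set X) (φ : X → ℝ)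
    {C ℓ κ vol6 e₁ e₂ e₃ : ℝ}
    (h1 : |(1 / 2 : ℝ) * (S6ᶜ.indicator φ ⬝ᵥ Δ' *ᵥ S6ᶜ.indicator φ)
        - (1 / 2 : ℝ) * (S6ᶜ.indicator φ ⬝ᵥ Δ *ᵥ S6ᶜ.indicator φ)| ≤ e₁)
    (h2 : |S6ᶜ.indicator φ ⬝ᵥ Δ' *ᵥ (S6 ∩ S7c).indicator φ - S6ᶜ.indicator φ ⬝ᵥ Δ *ᵥ S6.indicator φ| ≤ e₂)
    (h3 : |(1 / 2 : ℝ) * (S6.indicator φ ⬝ᵥ Δ'' *ᵥ S6.indicator φ)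
        - (1 / 2 : ℝ) * (S6.indicator φ ⬝ᵥ Δ *ᵥ S6.indicator φ)| ≤ e₃)
    (hsum : e₁ + e₂ + e₃ ≤ C * ℓ ^ κ * vol6) :
    Eq247 C ℓ κ vol6 ((1 / 2 : ℝ) * (φ ⬝ᵥ Δ *ᵥ φ))
      ((1 / 2 : ℝ) * (S6ᶜ.indicator φ ⬝ᵥ Δ' *ᵥ S6ᶜ.indicator φ))
      (S6ᶜ.indicator φ ⬝ᵥ Δ' *ᵥ (S6 ∩ S7c).indicator φ)
      ((1 / 2 : ℝ) * (S6.indicator φ ⬝ᵥ Δ'' *ᵥ S6.indicator φ)) := by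
  unfold Eq247
  rw [eq247_exact Δ hΔ S6 φ]
  set a := (1 / 2 : ℝ) * (S6ᶜ.indicator φ ⬝ᵥ Δ *ᵥ S6ᶜ.indicator φ)
  set b := S6ᶜ.indicator φ ⬝ᵥ Δ *ᵥ S6.indicator φ
  set c := (1 / 2 : ℝ) * (S6.indicator φ ⬝ᵥ Δ *ᵥ S6.indicator φ)
  set a' := (1 / 2 : ℝ) * (S6ᶜ.indicator φ ⬝ᵥ Δ' *ᵥ S6ᶜ.indicator φ)
  set b' := S6ᶜ.indicator φ ⬝ᵥ Δ' *ᵥ (S6 ∩ S7c).indicator φ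
  set c' := (1 / 2 : ℝ) * (S6.indicator φ ⬝ᵥ Δ'' *ᵥ S6.indicator φ)
  have : a + b + c - (a' + b' + c') = -((a' - a) + (b' - b) + (c' - c)) := by ring
  rw [this, abs_neg]
  calc |a' - a + (b' - b) + (c' - c)| ≤ |a' - a| + |b' - b| + |c' - c| := abs_add_three _ _ _
    _ ≤ e₁ + e₂ + e₃ := by gcongr
    _ ≤ C * ℓ ^ κ * vol6 := hsum

end Split

/-! ## §2 (2.48) p. 568: «ρ″ = ρ·exp(O((L^{k−1}ε)^κ)|Λ₅^{(k−1)}|)» -/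

section Eq248

/-- **(2.48)** p. 568, verbatim: *"ρ″^{(k),L^k}(Λ₀^{(0)},…,Λ₀^{(k−1)}, A, θ_kA^{(k),ε}, φ) = ρ^{(k),L^kε}(Λ₀^{(0)},…,Λ₀^{(k−1)}, A,
θ_kA^{(k),ε}, φ)·exp(O((L^{k−1}ε)^κ)|Λ₅^{(k−1)}|)"* — TYPED at one field configuration as: the value `ρ''` equals the value
`ρ` times `exp(c·ℓ^κ·vol5)` for some `|c| ≤ C` (`ℓ` ↤ L^{k−1}ε, `vol5` ↤ |Λ₅^{(k−1)}|, `C` ↤ the O(1) constant, uniform in k,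
ε and the fields). [cite: Balaban1982Higgs2, (2.48) p.568] -/
def Eq248 (C ℓ κ vol5 ρ'' ρ : ℝ) : Prop :=
  ∃ c : ℝ, |c| ≤ C ∧ ρ'' = ρ * Real.exp (c * (ℓ ^ κ * vol5))

variable {C C₁ C₂ ℓ κ vol5 ρ'' ρ ρ₀ ρ₁'' ρ₁ ρ₂'' ρ₂ : ℝ}

/-- (2.48) with the constant 0 is equality. KERNEL. [cite: Balaban1982Higgs2, (2.48) p.568] -/
theorem Eq248.rfl_of (hC : 0 ≤ C) : Eq248 C ℓ κ vol5 ρ ρ :=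
  ⟨0, by simpa using hC, by simp⟩

/-- (2.48) ⇒ the UPPER bound `ρ″ ≤ ρ·exp(C·ℓ^κ·|Λ₅|)` for a non-negative density (ℓ^κ|Λ₅| ≥ 0). KERNEL.
[cite: Balaban1982Higgs2, (2.48) p.568] -/
theorem Eq248.upper (h : Eq248 C ℓ κ vol5 ρ'' ρ) (hρ : 0 ≤ ρ) (hw : 0 ≤ ℓ ^ κ * vol5) :
    ρ'' ≤ ρ * Real.exp (C * (ℓ ^ κ * vol5)) := by
  obtain ⟨c, hc, rfl⟩ := h
  gcongr
  exact (le_abs_self c).trans hc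

/-- (2.48) ⇒ the LOWER bound `ρ·exp(−C·ℓ^κ·|Λ₅|) ≤ ρ″` for a non-negative density. KERNEL.
[cite: Balaban1982Higgs2, (2.48) p.568] -/
theorem Eq248.lower (h : Eq248 C ℓ κ vol5 ρ'' ρ) (hρ : 0 ≤ ρ) (hw : 0 ≤ ℓ ^ κ * vol5) :
    ρ * Real.exp (-C * (ℓ ^ κ * vol5)) ≤ ρ'' := by
  obtain ⟨c, hc, rfl⟩ := h
  gcongr
  exact (neg_le_neg hc).trans (neg_abs_le c)

/-- (2.48)-relations compose (the constants add): used when the factor of (2.48) is absorbed together with the other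
`exp(O(·)|·|)` factors into (2.43). KERNEL. [cite: Balaban1982Higgs2, (2.48) p.568] -/
theorem Eq248.trans (h₁ : Eq248 C₁ ℓ κ vol5 ρ'' ρ) (h₂ : Eq248 C₂ ℓ κ vol5 ρ ρ₀) :
    Eq248 (C₁ + C₂) ℓ κ vol5 ρ'' ρ₀ := by
  obtain ⟨c₁, hc₁, rfl⟩ := h₁
  obtain ⟨c₂, hc₂, rfl⟩ := h₂
  refine ⟨c₁ + c₂, (abs_add_le _ _).trans (add_le_add hc₁ hc₂), ?_⟩
  rw [add_mul, Real.exp_add]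
  ring

/-- (2.48)-relations multiply (products of densities; constants add). KERNEL. [cite: Balaban1982Higgs2, (2.48) p.568] -/
theorem Eq248.mul (h₁ : Eq248 C₁ ℓ κ vol5 ρ₁'' ρ₁) (h₂ : Eq248 C₂ ℓ κ vol5 ρ₂'' ρ₂) :
    Eq248 (C₁ + C₂) ℓ κ vol5 (ρ₁'' * ρ₂'') (ρ₁ * ρ₂) := by
  obtain ⟨c₁, hc₁, rfl⟩ := h₁
  obtain ⟨c₂, hc₂, rfl⟩ := h₂
  refine ⟨c₁ + c₂, (abs_add_le _ _).trans (add_le_add hc₁ hc₂), ?_⟩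
  rw [add_mul, Real.exp_add]
  ring

/-- (2.48) is monotone in the constant. KERNEL. [cite: Balaban1982Higgs2, (2.48) p.568] -/
theorem Eq248.mono (h : Eq248 C₁ ℓ κ vol5 ρ'' ρ) (hC : C₁ ≤ C₂) : Eq248 C₂ ℓ κ vol5 ρ'' ρ := by
  obtain ⟨c, hc, h⟩ := h
  exact ⟨c, hc.trans hC, h⟩

/-- Conversely, a positive density within the two-sided exponential window satisfies (2.48) (for ℓ^κ|Λ₅| > 0): the
printed «= ρ·exp(O(·))» and the two-sided estimate are the same statement. KERNEL. [cite: Balaban1982Higgs2, (2.48) p.568] -/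
theorem eq248_of_bounds (hρ : 0 < ρ) (hw : 0 < ℓ ^ κ * vol5)
    (hlo : ρ * Real.exp (-C * (ℓ ^ κ * vol5)) ≤ ρ'') (hhi : ρ'' ≤ ρ * Real.exp (C * (ℓ ^ κ * vol5))) :
    Eq248 C ℓ κ vol5 ρ'' ρ := by
  have hρ'' : 0 < ρ'' := lt_of_lt_of_le (mul_pos hρ (Real.exp_pos _)) hlo
  refine ⟨Real.log (ρ'' / ρ) / (ℓ ^ κ * vol5), ?_, ?_⟩
  · rw [abs_div, abs_of_pos hw, div_le_iff₀ hw, abs_le]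
    constructor
    · have := Real.log_le_log (mul_pos hρ (Real.exp_pos _)) hlo
      rw [Real.log_mul hρ.ne' (Real.exp_pos _).ne', Real.log_exp] at this
      rw [Real.log_div hρ''.ne' hρ.ne']
      linarith
    · have := Real.log_le_log hρ'' hhi
      rw [Real.log_mul hρ.ne' (Real.exp_pos _).ne', Real.log_exp] at this
      rw [Real.log_div hρ''.ne' hρ.ne']
      linarith
  · rw [div_mul_cancel₀ _ hw.ne', Real.exp_log (div_pos hρ'' hρ)]
    field_simp

end Eq248

/-! ## §3 (2.49) p. 568 (and (2.41) p. 566): the basic Gaussian factor and ρ = ρ′·(Gaussian on Λ₆′) -/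

section Eq249

variable {X P : Type*} [Fintype X] [Fintype P]

/-- A density after k steps as a function of the field components `A : X → ℝ`, `φ : P → ℝ` (regions and the external
field θ_kA^{(k),ε} are parameters — p. 568 *"Here we treat θ_kA^{(k)} as an independent field configuration"*).
[cite: Balaban1982Higgs2, (2.48)–(2.50) p.568] -/
abbrev Density (X P : Type*) := (X → ℝ) → (P → ℝ) → ℝ

/-- **the basic Gaussian density after k renormalization transformations** (display before (2.47), p. 568, verbatim:
*"exp[−½⟨A, Δ^{(k),L^kε}A⟩ − ½⟨φ, Δ^{(k),L^kε}(B^{k−1}(Λ₂^{(k−1)}), A^{(k),ε})φ⟩]"*), `ΔA` ↤ Δ^{(k),L^kε}, `Δφ` ↤ the scalar-field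
operator in the background. [cite: Balaban1982Higgs2, (2.47) p.568] -/
noncomputable def basicGaussian (ΔA : Matrix X X ℝ) (Δφ : Matrix P P ℝ) (A : X → ℝ) (φ : P → ℝ) : ℝ :=
  Real.exp (-(1 / 2 : ℝ) * (A ⬝ᵥ ΔA *ᵥ A) - (1 / 2 : ℝ) * (φ ⬝ᵥ Δφ *ᵥ φ))

/-- The basic Gaussian density is positive. KERNEL. [cite: Balaban1982Higgs2, (2.47) p.568] -/
theorem basicGaussian_pos (ΔA : Matrix X X ℝ) (Δφ : Matrix P P ℝ) (A : X → ℝ) (φ : P → ℝ) :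
    0 < basicGaussian ΔA Δφ A φ :=
  Real.exp_pos _

/-- **the exponential factor of (2.49)** p. 568: `exp[−½⟨Λ₆′A, ΔΛ₆′A⟩ − ½⟨Λ₆′φ, Δ(…)Λ₆′φ⟩]` — the basic Gaussian density
evaluated on the fields RESTRICTED to Λ₆^{(k−1)′} (`S6` ↤ the A-components in Λ₆^{(k−1)′}, `S6'` ↤ the φ-components there).
[cite: Balaban1982Higgs2, (2.49) p.568] -/
noncomputable def factor249 (S6 : Set X) (S6' : Set P) (ΔA : Matrix X X ℝ) (Δφ : Matrix P P ℝ)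
    (A : X → ℝ) (φ : P → ℝ) : ℝ :=
  basicGaussian ΔA Δφ (S6.indicator A) (S6'.indicator φ)

/-- `factor249` unfolded. [cite: Balaban1982Higgs2, (2.49) p.568] -/
theorem factor249_eq (S6 : Set X) (S6' : Set P) (ΔA : Matrix X X ℝ) (Δφ : Matrix P P ℝ)
    (A : X → ℝ) (φ : P → ℝ) :
    factor249 S6 S6' ΔA Δφ A φ = Real.exp (-(1 / 2 : ℝ) * (S6.indicator A ⬝ᵥ ΔA *ᵥ S6.indicator A)
      - (1 / 2 : ℝ) * (S6'.indicator φ ⬝ᵥ Δφ *ᵥ S6'.indicator φ)) := rfl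

/-- The (2.49) factor is positive. KERNEL. [cite: Balaban1982Higgs2, (2.49) p.568] -/
theorem factor249_pos (S6 : Set X) (S6' : Set P) (ΔA : Matrix X X ℝ) (Δφ : Matrix P P ℝ)
    (A : X → ℝ) (φ : P → ℝ) : 0 < factor249 S6 S6' ΔA Δφ A φ :=
  Real.exp_pos _

/-- **(2.49)** p. 568 read left-to-right: the density ρ^{(k),L^kε} obtained from ρ′^{(k),L^kε} by multiplying with the basic
Gaussian factor on Λ₆^{(k−1)′}: `ρ(A,φ) = ρ′(A,φ)·exp[−½⟨Λ₆′A,ΔΛ₆′A⟩ − ½⟨Λ₆′φ,Δ(…)Λ₆′φ⟩]`.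
[cite: Balaban1982Higgs2, (2.49) p.568] -/
noncomputable def rho249 (ρ' : Density X P) (S6 : Set X) (S6' : Set P) (ΔA : Matrix X X ℝ)
    (Δφ : Matrix P P ℝ) : Density X P :=
  fun A φ => ρ' A φ * factor249 S6 S6' ΔA Δφ A φ

/-- **(2.49)** p. 568 read as the text uses it, verbatim *"if we define a density ρ′^{(k),L^kε} by the equality (2.49)"*:
ρ′ := ρ / (the basic Gaussian factor on Λ₆^{(k−1)′}). [cite: Balaban1982Higgs2, (2.49) p.568] -/
noncomputable def rhoPrime249 (ρ : Density X P) (S6 : Set X) (S6' : Set P) (ΔA : Matrix X X ℝ)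
    (Δφ : Matrix P P ℝ) : Density X P :=
  fun A φ => ρ A φ / factor249 S6 S6' ΔA Δφ A φ

/-- `rho249` at a configuration. [cite: Balaban1982Higgs2, (2.49) p.568] -/
theorem rho249_apply (ρ' : Density X P) (S6 : Set X) (S6' : Set P) (ΔA : Matrix X X ℝ)
    (Δφ : Matrix P P ℝ) (A : X → ℝ) (φ : P → ℝ) :
    rho249 ρ' S6 S6' ΔA Δφ A φ = ρ' A φ * factor249 S6 S6' ΔA Δφ A φ := rfl

/-- `rhoPrime249` at a configuration. [cite: Balaban1982Higgs2, (2.49) p.568] -/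
theorem rhoPrime249_apply (ρ : Density X P) (S6 : Set X) (S6' : Set P) (ΔA : Matrix X X ℝ)
    (Δφ : Matrix P P ℝ) (A : X → ℝ) (φ : P → ℝ) :
    rhoPrime249 ρ S6 S6' ΔA Δφ A φ = ρ A φ / factor249 S6 S6' ΔA Δφ A φ := rfl

/-- **(2.49) holds for the ρ′ it defines**: `ρ = ρ′·exp[…]` exactly (the factor never vanishes). KERNEL.
[cite: Balaban1982Higgs2, (2.49) p.568] -/
theorem eq249 (ρ : Density X P) (S6 : Set X) (S6' : Set P) (ΔA : Matrix X X ℝ) (Δφ : Matrix P P ℝ) :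
    rho249 (rhoPrime249 ρ S6 S6' ΔA Δφ) S6 S6' ΔA Δφ = ρ := by
  funext A φ
  rw [rho249_apply, rhoPrime249_apply, div_mul_cancel₀ _ (factor249_pos S6 S6' ΔA Δφ A φ).ne']

/-- Conversely the ρ′ of a density of the form (2.49) is recovered by the division. KERNEL.
[cite: Balaban1982Higgs2, (2.49) p.568] -/
theorem rhoPrime249_rho249 (ρ' : Density X P) (S6 : Set X) (S6' : Set P) (ΔA : Matrix X X ℝ)
    (Δφ : Matrix P P ℝ) :
    rhoPrime249 (rho249 ρ' S6 S6' ΔA Δφ) S6 S6' ΔA Δφ = ρ' := by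
  funext A φ
  rw [rhoPrime249_apply, rho249_apply, mul_div_cancel_right₀ _ (factor249_pos S6 S6' ΔA Δφ A φ).ne']

/-- ρ and ρ′ of (2.49) have the same sign pattern: ρ ≥ 0 iff ρ′ ≥ 0 (the factor is > 0). KERNEL.
[cite: Balaban1982Higgs2, (2.49) p.568] -/
theorem rho249_nonneg_iff (ρ' : Density X P) (S6 : Set X) (S6' : Set P) (ΔA : Matrix X X ℝ)
    (Δφ : Matrix P P ℝ) (A : X → ℝ) (φ : P → ℝ) :
    0 ≤ rho249 ρ' S6 S6' ΔA Δφ A φ ↔ 0 ≤ ρ' A φ := by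
  rw [rho249_apply]
  exact mul_nonneg_iff_of_pos_right (factor249_pos S6 S6' ΔA Δφ A φ)

/-- **(2.41)** p. 566 [PDF 12], verbatim: *"ρ^{(1),L}(Λ₀, B, θ₁B^{(1)}, ψ) = ρ′^{(1),L}(Λ₀, B, θ₁B^{(1)}, ψ)·exp[−½⟨Λ′₆B,
Δ^{(1),L}Λ′₆B⟩ − ½⟨Λ′₆ψ, Δ^{(1),L}(Λ₂, B^{(1)})Λ′₆ψ⟩]"* — the k = 1 instance of (2.49) (fields (B, ψ), masks Λ′₆, operators
Δ^{(1),L}, Δ^{(1),L}(Λ₂, B^{(1)})): with ρ′^{(1),L} := `rhoPrime249 ρ Λ′₆ Λ′₆ Δ Δ(Λ₂,B^{(1)})` (p. 566: *"ρ′^{(1),L} … obtained from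
ρ^{(1),L} … by removing the basic quadratic forms on Λ′₆"*) the display holds exactly. KERNEL.
[cite: Balaban1982Higgs2, (2.41) p.566] -/
theorem eq241 (ρ : Density X P) (S6 : Set X) (S6' : Set P) (Δ : Matrix X X ℝ) (ΔB : Matrix P P ℝ)
    (B : X → ℝ) (ψ : P → ℝ) :
    ρ B ψ = rhoPrime249 ρ S6 S6' Δ ΔB B ψ * Real.exp (-(1 / 2 : ℝ) * (S6.indicator B ⬝ᵥ Δ *ᵥ S6.indicator B)
      - (1 / 2 : ℝ) * (S6'.indicator ψ ⬝ᵥ ΔB *ᵥ S6'.indicator ψ)) := by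
  rw [rhoPrime249_apply, ← factor249_eq, div_mul_cancel₀ _ (factor249_pos S6 S6' Δ ΔB B ψ).ne']

end Eq249

/-! ## §4 (2.50) p. 568 (and (2.42) p. 566): ρ′ depends on the fields only through Λ₇^{(k−1)′c}A, Λ₇^{(k−1)′c}φ -/

section Eq250

variable {X P : Type*}

/-- **(2.50)** p. 568, verbatim: *"ρ′^{(k),L^kε}(Λ₀^{(0)},…,Λ₀^{(k−1)}, A, θ_kA^{(k),ε}, φ) = ρ′^{(k),L^kε}(Λ₀^{(0)},…,Λ₀^{(k−1)},
Λ₇^{(k−1)′c}A, θ_kA^{(k),ε}, Λ₇^{(k−1)′c}φ)"* — TYPED as a predicate on a density: it is unchanged when A, φ are replaced by their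
restrictions to Λ₇^{(k−1)′c} (`S7c`, `S7c'` ↤ the A- and φ-components in Λ₇^{(k−1)′c}). [cite: Balaban1982Higgs2, (2.50) p.568] -/
def Local250 (S7c : Set X) (S7c' : Set P) (ρ' : Density X P) : Prop :=
  ∀ A φ, ρ' A φ = ρ' (S7c.indicator A) (S7c'.indicator φ)

/-- (2.50) says exactly: ρ′ depends on A, φ only through their values on Λ₇^{(k−1)′c} — two configurations agreeing there
give the same ρ′. KERNEL. [cite: Balaban1982Higgs2, (2.50) p.568] -/
theorem Local250.eq_of_eqOn {S7c : Set X} {S7c' : Set P} {ρ' : Density X P} (h : Local250 S7c S7c' ρ')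
    {A A₂ : X → ℝ} {φ φ₂ : P → ℝ} (hA : Set.EqOn A A₂ S7c) (hφ : Set.EqOn φ φ₂ S7c') :
    ρ' A φ = ρ' A₂ φ₂ := by
  rw [h A φ, h A₂ φ₂, Set.indicator_congr hA, Set.indicator_congr hφ]

/-- Any function of the restricted fields satisfies (2.50) (restriction is idempotent). KERNEL.
[cite: Balaban1982Higgs2, (2.50) p.568] -/
theorem local250_comp (S7c : Set X) (S7c' : Set P) (F : Density X P) :
    Local250 S7c S7c' (fun A φ => F (S7c.indicator A) (S7c'.indicator φ)) := by
  intro A φ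
  simp only [Set.indicator_indicator, Set.inter_self]

/-- (2.50) characterized: ρ′ satisfies it iff ρ′ IS a function of (Λ₇′ᶜA, Λ₇′ᶜφ). KERNEL.
[cite: Balaban1982Higgs2, (2.50) p.568] -/
theorem local250_iff (S7c : Set X) (S7c' : Set P) (ρ' : Density X P) :
    Local250 S7c S7c' ρ' ↔ ∃ F : Density X P, ρ' = fun A φ => F (S7c.indicator A) (S7c'.indicator φ) := by
  constructor
  · intro h
    exact ⟨ρ', funext fun A => funext fun φ => h A φ⟩
  · rintro ⟨F, rfl⟩
    exact local250_comp S7c S7c' F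

/-- Products of densities with the property (2.50) have it (the factors Z^{(j)} etc. are assembled this way). KERNEL.
[cite: Balaban1982Higgs2, (2.50) p.568] -/
theorem Local250.mul {S7c : Set X} {S7c' : Set P} {ρ₁ ρ₂ : Density X P} (h₁ : Local250 S7c S7c' ρ₁)
    (h₂ : Local250 S7c S7c' ρ₂) : Local250 S7c S7c' (fun A φ => ρ₁ A φ * ρ₂ A φ) := by
  intro A φ
  simp only [← h₁ A φ, ← h₂ A φ]

/-- A density not depending on (A, φ) at all (e.g. a pure function of the external field θ_kA^{(k),ε}) has the property
(2.50). KERNEL. [cite: Balaban1982Higgs2, (2.50) p.568] -/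
theorem Local250.const (S7c : Set X) (S7c' : Set P) (c : ℝ) : Local250 S7c S7c' (fun _ _ => c) :=
  fun _ _ => rfl

/-- (2.50) is inherited along enlargements of the region: if ρ′ only sees Λ₇′ᶜ and Λ₇′ᶜ ⊆ W (componentwise `S7c ⊆ W`,
`S7c' ⊆ W'`), then ρ′ only sees W. KERNEL. [cite: Balaban1982Higgs2, (2.50) p.568] -/
theorem Local250.mono {S7c W : Set X} {S7c' W' : Set P} {ρ' : Density X P} (h : Local250 S7c S7c' ρ')
    (hW : S7c ⊆ W) (hW' : S7c' ⊆ W') : Local250 W W' ρ' := by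
  intro A φ
  rw [h A φ, h (W.indicator A) (W'.indicator φ), Set.indicator_indicator, Set.indicator_indicator,
    Set.inter_eq_left.2 hW, Set.inter_eq_left.2 hW']

/-- **(2.42)** p. 566 [PDF 12], verbatim: *"ρ′^{(1),L}(Λ₀, B, θ₁B^{(1)}, ψ) = ρ′^{(1),L}(Λ₀, Λ′₇ᶜB, θ₁B^{(1)}, Λ′₇ᶜψ)"* — the k = 1
instance of (2.50): the first-step density ρ′^{(1),L} has the property `Local250 Λ′₇ᶜ Λ′₇ᶜ` (as a function of (B, ψ); Λ₀ and
θ₁B^{(1)} parameters), and this is the same as being a function of (Λ′₇ᶜB, Λ′₇ᶜψ). KERNEL (instance of `local250_iff`).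
[cite: Balaban1982Higgs2, (2.42) p.566] -/
theorem local242_iff (S7c : Set X) (S7c' : Set P) (ρ'₁ : Density X P) :
    Local250 S7c S7c' ρ'₁ ↔ ∀ B ψ, ρ'₁ B ψ = ρ'₁ (S7c.indicator B) (S7c'.indicator ψ) :=
  Iff.rfl

end Eq250

/-! ## §5 (2.51) p. 569 and the local form «Ã» of (2.45) p. 567: the whole external vector field -/

section Eq251

variable {X M : Type*} [AddCommGroup M] [Module ℝ M]

/-- **(2.51)** p. 569, verbatim: *"Ã^ε = (1 − θ₁)A₀ + Σ_{j=1}^{k−1}(1 − θ_{j+1})θ_jA^{(j),ε} + θ_kA^{(k),ε}"* — pointwise on the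
lattice (`θ j : X → ℝ` ↤ θ_j, `A₀` ↤ A₀, `A j` ↤ A^{(j),ε} of (2.44) at scale j; values in a real vector space `M` ↤ ℝ^d),
for k ≥ 1 steps. [cite: Balaban1982Higgs2, (2.51) p.569] -/
def aTilde251 (θ : ℕ → X → ℝ) (A₀ : X → M) (A : ℕ → X → M) (k : ℕ) : X → M :=
  fun x => (1 - θ 1 x) • A₀ x + (∑ j ∈ Ico 1 k, ((1 - θ (j + 1) x) * θ j x) • A j x) + θ k x • A k x

/-- The COEFFICIENTS of (2.51) at a point: `(1 − θ₁) + Σ_{j=1}^{k−1}(1 − θ_{j+1})θ_j + θ_k`.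
[cite: Balaban1982Higgs2, (2.51) p.569] -/
def coeffSum251 (θ : ℕ → X → ℝ) (k : ℕ) (x : X) : ℝ :=
  (1 - θ 1 x) + (∑ j ∈ Ico 1 k, (1 - θ (j + 1) x) * θ j x) + θ k x

/-- The NESTING of the cut-offs θ_j (p. 567: θ_j = 1 on B^{j−1}(Λ₂^{(j−1)}) and supported in an M-slice around it; the
regions shrink with j, Λ₂^{(j)} ⊂ B^{j−1}(Λ₂^{(j−1)}) well inside the set where θ_j = 1): `θ_{j+1}·θ_j = θ_{j+1}` for j ≥ 1,
i.e. θ_j = 1 wherever θ_{j+1} ≠ 0 — the hypothesis under which (2.51) telescopes. (θ₀ is not used.)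
[cite: Balaban1982Higgs2, (2.51) p.569] -/
def Nested (θ : ℕ → X → ℝ) : Prop :=
  ∀ j x, 1 ≤ j → θ (j + 1) x * θ j x = θ (j + 1) x

/-- Under nesting, θ_{j+d} = 1 at x forces θ_j = 1 at x (j ≥ 1): downward induction on d. KERNEL.
[cite: Balaban1982Higgs2, (2.51) p.569] -/
theorem Nested.eq_one_of_add {θ : ℕ → X → ℝ} (hθ : Nested θ) {x : X} :
    ∀ d j : ℕ, 1 ≤ j → θ (j + d) x = 1 → θ j x = 1 := by
  intro d
  induction d with
  | zero => intro j _ h; simpa using h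
  | succ d ih =>
    intro j hj h
    have h2 := hθ (j + d) x (le_trans hj (Nat.le_add_right j d))
    rw [← add_assoc] at h
    rw [h, one_mul] at h2
    exact ih j hj h2

/-- Under nesting, θ_n = 1 at x forces θ_j = 1 at x for all 1 ≤ j ≤ n. KERNEL. [cite: Balaban1982Higgs2, (2.51) p.569] -/
theorem Nested.eq_one_of_le {θ : ℕ → X → ℝ} (hθ : Nested θ) {n : ℕ} {x : X} (hn : θ n x = 1) :
    ∀ j, 1 ≤ j → j ≤ n → θ j x = 1 := by
  intro j hj hjn
  obtain ⟨d, rfl⟩ := Nat.exists_eq_add_of_le hjn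
  exact hθ.eq_one_of_add d j hj hn

/-- **the coefficients of (2.51) sum to 1** under nesting (k ≥ 1): Σ_{j=1}^{k−1}(θ_j − θ_{j+1}θ_j) telescopes to θ₁ − θ_k.
So (2.51) is an affine (for 0 ≤ θ ≤ 1: convex) combination of A₀, A^{(1),ε}, …, A^{(k),ε} at every point. KERNEL.
[cite: Balaban1982Higgs2, (2.51) p.569] -/
theorem coeffSum251_eq_one {θ : ℕ → X → ℝ} (hθ : Nested θ) {k : ℕ} (hk : 1 ≤ k) (x : X) :
    coeffSum251 θ k x = 1 := by
  induction k, hk using Nat.le_induction with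
  | base => simp [coeffSum251]
  | succ k hk ih =>
    unfold coeffSum251 at ih ⊢
    rw [Finset.sum_Ico_succ_top hk]
    have := hθ k x hk
    linear_combination ih - this

/-- The coefficients of (2.51) are non-negative when 0 ≤ θ_j ≤ 1 (so, with `coeffSum251_eq_one`, Ã^ε(x) is a convex
combination of A₀(x), A^{(1),ε}(x), …, A^{(k),ε}(x)). KERNEL. [cite: Balaban1982Higgs2, (2.51) p.569] -/
theorem coeff251_nonneg {θ : ℕ → X → ℝ} (h0 : ∀ j x, 0 ≤ θ j x) (h1 : ∀ j x, θ j x ≤ 1) (j : ℕ) (x : X) :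
    0 ≤ 1 - θ 1 x ∧ 0 ≤ (1 - θ (j + 1) x) * θ j x ∧ 0 ≤ θ j x :=
  ⟨sub_nonneg.2 (h1 1 x), mul_nonneg (sub_nonneg.2 (h1 _ x)) (h0 j x), h0 j x⟩

/-- (2.51) for k = 1: `Ã^ε = (1 − θ₁)A₀ + θ₁A^{(1),ε}` — the shape of (2.35) p. 564 «B̃^{(1)} = (1 − θ₁)A + θ₁B^{(1)}» (first
step: A₀ the original field, A^{(1),ε} ↤ B^{(1)}). KERNEL. [cite: Balaban1982Higgs2, (2.51) p.569] -/
theorem aTilde251_one (θ : ℕ → X → ℝ) (A₀ : X → M) (A : ℕ → X → M) (x : X) :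
    aTilde251 θ A₀ A 1 x = (1 - θ 1 x) • A₀ x + θ 1 x • A 1 x := by
  simp [aTilde251]

/-- **one-step recursion of (2.51)** (exact, no nesting needed): Ã^ε_{k+1} = Ã^ε_k + θ_{k+1}(A^{(k+1),ε} − θ_kA^{(k),ε}) for
k ≥ 1 — *"In each step we expand these factors with respect to a new small field, hence the configuration Ã^ε is changed
after each step"* (p. 569). KERNEL. [cite: Balaban1982Higgs2, (2.51) p.569] -/
theorem aTilde251_succ (θ : ℕ → X → ℝ) (A₀ : X → M) (A : ℕ → X → M) {k : ℕ} (hk : 1 ≤ k) (x : X) :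
    aTilde251 θ A₀ A (k + 1) x = aTilde251 θ A₀ A k x + θ (k + 1) x • (A (k + 1) x - θ k x • A k x) := by
  simp only [aTilde251, Finset.sum_Ico_succ_top hk, smul_sub, sub_mul, one_mul, sub_smul, mul_smul]
  abel

/-- The recursion under nesting: Ã^ε_{k+1} = Ã^ε_k + θ_{k+1}(A^{(k+1),ε} − A^{(k),ε}) (k ≥ 1). KERNEL.
[cite: Balaban1982Higgs2, (2.51) p.569] -/
theorem aTilde251_succ_of_nested {θ : ℕ → X → ℝ} (hθ : Nested θ) (A₀ : X → M) (A : ℕ → X → M) {k : ℕ}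
    (hk : 1 ≤ k) (x : X) :
    aTilde251 θ A₀ A (k + 1) x = aTilde251 θ A₀ A k x + θ (k + 1) x • (A (k + 1) x - A k x) := by
  rw [aTilde251_succ θ A₀ A hk, smul_sub, smul_sub, ← mul_smul, hθ k x hk]

/-- **«Ã» of (2.45)** p. 567, verbatim: *"where Ã = (1 − θ_k)θ_{k−1}A^{(k−1),ε} + θ_kA^{(k),ε}"* — the two-scale form of the
external field entering the k-th step (`θk`, `θkm1` ↤ θ_k, θ_{k−1}; `Akm1`, `Ak` ↤ A^{(k−1),ε}, A^{(k),ε}).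
[cite: Balaban1982Higgs2, (2.45) p.567] -/
def aTilde245 (θk θkm1 : X → ℝ) (Akm1 Ak : X → M) : X → M :=
  fun x => ((1 - θk x) * θkm1 x) • Akm1 x + θk x • Ak x

/-- **p. 569, verbatim: «Obviously we have B^{k−2}(Λ₂^{(k−2)})Ã^ε = Ã′»** — at a point where θ_{k−1} = 1 (θ_{k−1} ≡ 1 on
B^{k−2}(Λ₂^{(k−2)}), p. 567) and under nesting, the whole external field (2.51) with k steps IS the two-term «Ã» of (2.45):
all earlier coefficients vanish. Stated with `k = m + 2` (k ≥ 2). KERNEL. [cite: Balaban1982Higgs2, (2.51) p.569] -/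
theorem aTilde251_eq_aTilde245 {θ : ℕ → X → ℝ} (hθ : Nested θ) (A₀ : X → M) (A : ℕ → X → M) (m : ℕ) {x : X}
    (hx : θ (m + 1) x = 1) :
    aTilde251 θ A₀ A (m + 2) x = aTilde245 (θ (m + 2)) (θ (m + 1)) (A (m + 1)) (A (m + 2)) x := by
  have hall : ∀ j, 1 ≤ j → j ≤ m + 1 → θ j x = 1 := hθ.eq_one_of_le hx
  have h1 : θ 1 x = 1 := hall 1 le_rfl (by omega)
  have hsum : ∑ j ∈ Ico 1 (m + 1), ((1 - θ (j + 1) x) * θ j x) • A j x = 0 := by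
    refine Finset.sum_eq_zero fun j hj => ?_
    rw [Finset.mem_Ico] at hj
    rw [hall (j + 1) (by omega) (by omega), sub_self, zero_mul, zero_smul]
  have hm : (m + 2 : ℕ) = (m + 1) + 1 := rfl
  simp only [aTilde251, aTilde245, hm, Finset.sum_Ico_succ_top (show 1 ≤ m + 1 by omega), hsum, h1, sub_self,
    zero_smul, zero_add]

end Eq251

/-! ## §6 (2.52) p. 569 (and p. 565): the Gaussian factors Z^{(j),L^jε}_{Λ₅^{(j)}} -/

section Eq252

variable {T : Type*} [Fintype T] [DecidableEq T]

omit [DecidableEq T] in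
/-- **(2.52)** p. 569, verbatim: *"Z^{(j),L^jε}_{Λ₅^{(j)}}(B^j(Λ₂^{(j)}), Ã^ε) = (a(L^{j+1}ε)^{d−2}/2π)^{(N/2)|Λ₅^{(j)}|} ∫dφ↾_{Λ₅^{(j)}}
exp(−½⟨φ, (C^{(j),L^jε}_{Λ₅^{(j)}}(B^j(Λ₂^{(j)}), Ã^ε))^{−1}φ⟩) for j = 0, 1, …, k − 1"* — typed reading: `T` ↤ the sites of Λ₅^{(j)},
`φ : T × Fin N → ℝ`, Lebesgue `dφ`, base `a(L^{j+1}ε)^{d−2}` = `B1RT.prec a ℓ' d` (`ℓ'` ↤ L^{j+1}ε), `Cinv` ↤ the matrix of the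
printed form. This IS part I's (3.32) normalization `B1GaussNorm331.ZkA` *"calculated on the set Λ₅ instead of T_ε"*
(p. 565), REUSED by name. The sentence *"ρ′^{(k),L^kε} depends on the configuration B^k(Λ₇^{(k−1)′})A^{(k),ε} through the
factors Z^{(j),L^jε}_{Λ₅^{(j)}}(B^j(Λ₂^{(j)}), A^ε) only"* (p. 568) is recorded, not typed. [cite: Balaban1982Higgs2, (2.52) p.569] -/
noncomputable def Z252 (d N : ℕ) (a ℓ' : ℝ) (Cinv : Matrix (T × Fin N) (T × Fin N) ℝ) : ℝ :=
  B1GaussNorm331.ZkA d N a ℓ' Cinv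

omit [DecidableEq T] in
/-- (2.52) is (I.3.32) on the set Λ₅^{(j)} (definitional). [cite: Balaban1982Higgs2, (2.52) p.569] -/
theorem Z252_eq_ZkA (d N : ℕ) (a ℓ' : ℝ) (Cinv : Matrix (T × Fin N) (T × Fin N) ℝ) :
    Z252 d N a ℓ' Cinv = B1GaussNorm331.ZkA d N a ℓ' Cinv := rfl

omit [DecidableEq T] in
/-- (2.52) written out: `(a(L^{j+1}ε)^{d−2}/2π)^{(N/2)|Λ₅^{(j)}|} ∫dφ exp(−½⟨φ, Cinv φ⟩)`. [cite: Balaban1982Higgs2, (2.52) p.569] -/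
theorem Z252_def (d N : ℕ) (a ℓ' : ℝ) (Cinv : Matrix (T × Fin N) (T × Fin N) ℝ) :
    Z252 d N a ℓ' Cinv = (B1RT.prec a ℓ' d / (2 * Real.pi)) ^ ((N : ℝ) / 2 * (Fintype.card T : ℝ))
      * ∫ φ : T × Fin N → ℝ, Real.exp (-(1 / 2 : ℝ) * (φ ⬝ᵥ Cinv *ᵥ φ)) := rfl

/-- **(2.52) IN CLOSED FORM**: for a ≥ 0, L^{j+1}ε > 0 and a positive definite form,
`Z^{(j)}_{Λ₅^{(j)}} = (a(L^{j+1}ε)^{d−2})^{(N/2)|Λ₅^{(j)}|} / √det Cinv`. KERNEL (`B1GaussNorm331.ZkA_eq`). [cite: Balaban1982Higgs2, (2.52) p.569] -/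
theorem Z252_eq (d N : ℕ) {a ℓ' : ℝ} (ha : 0 ≤ a) (hℓ : 0 < ℓ') {Cinv : Matrix (T × Fin N) (T × Fin N) ℝ}
    (hC : Cinv.PosDef) :
    Z252 d N a ℓ' Cinv = B1RT.prec a ℓ' d ^ ((N : ℝ) / 2 * (Fintype.card T : ℝ)) / Real.sqrt Cinv.det :=
  B1GaussNorm331.ZkA_eq d N ha hℓ hC

/-- `Z^{(j)}_{Λ₅^{(j)}} > 0` (a > 0, L^{j+1}ε > 0, positive definite form). KERNEL. [cite: Balaban1982Higgs2, (2.52) p.569] -/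
theorem Z252_pos (d N : ℕ) {a ℓ' : ℝ} (ha : 0 < a) (hℓ : 0 < ℓ') {Cinv : Matrix (T × Fin N) (T × Fin N) ℝ}
    (hC : Cinv.PosDef) : 0 < Z252 d N a ℓ' Cinv :=
  B1GaussNorm331.ZkA_pos d N ha hℓ hC

omit [DecidableEq T] in
/-- **p. 565 [PDF 11]**: the vector-field factor *"Z^{(0),ε}_{Λ₅}"* = the integral ∫dA↾_{Λ₅} exp(−½⟨A,(C^{(0)}_{Λ₅})⁻¹A⟩)
multiplied by (a(Lε)^{d−2}/2π)^{(d/2)|Λ₅|} — part I's (3.31) `B1GaussNorm331.Zk` on Λ₅ (base a(Lε)^{d−2}, `ℓ'` ↤ Lε), REUSED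
by name; its scalar partner Z^{(0),ε}_{Λ₅}(B^{(1)}) is `Z252` at j = 0. [cite: Balaban1982Higgs2, (2.34) p.565] -/
noncomputable def Zvec565 (d : ℕ) (a ℓ' : ℝ) (Cinv : Matrix (T × Fin d) (T × Fin d) ℝ) : ℝ :=
  B1GaussNorm331.Zk d a ℓ' Cinv

/-- The p. 565 vector-field factor in closed form: `(a(Lε)^{d−2})^{(d/2)|Λ₅|} / √det Cinv`. KERNEL (`B1GaussNorm331.Zk_eq`).
[cite: Balaban1982Higgs2, (2.34) p.565] -/
theorem Zvec565_eq (d : ℕ) {a ℓ' : ℝ} (ha : 0 ≤ a) (hℓ : 0 < ℓ') {Cinv : Matrix (T × Fin d) (T × Fin d) ℝ}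
    (hC : Cinv.PosDef) :
    Zvec565 d a ℓ' Cinv = B1RT.prec a ℓ' d ^ ((d : ℝ) / 2 * (Fintype.card T : ℝ)) / Real.sqrt Cinv.det :=
  B1GaussNorm331.Zk_eq d ha hℓ hC

/-- *"A product of these factors coming from each step of the procedure will be used in the sequel, instead of the
factors Z_k, Z_k(A) used in Chap. I.3"* (p. 565): the product Π_{j<k} Z^{(j)} of per-step factors (each on its own set
Λ₅^{(j)}, hence an abstract family `Z : ℕ → ℝ` here) is positive when each factor is. KERNEL. [cite: Balaban1982Higgs2, (2.52) p.569] -/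
theorem prod_Z252_pos {Z : ℕ → ℝ} (k : ℕ) (hZ : ∀ j < k, 0 < Z j) : 0 < ∏ j ∈ Finset.range k, Z j :=
  Finset.prod_pos fun j hj => hZ j (Finset.mem_range.1 hj)

end Eq252

/-! ## §7 (2.44) p. 566: the cut-off ζ^{(k)} EXISTS (a witness for `B2StepK.IsCutoff244`) -/

section Cutoff

variable {X Y B : Type}

/-- The clamp profile `ζ_R(x, y) = max(0, min(1, R − |x − y|))`: equal to 1 for |x − y| ≤ R − 1, to 0 for |x − y| ≥ R,
1-Lipschitz in the distance. With R = r(L^kε) − 2M it is the witness for (2.44)'s ζ^{(k)}. (`dist x y` ↤ |x − y|, x ∈ T_η,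
y ∈ T₁^{(k)}.) [cite: Balaban1982Higgs2, (2.44) p.566] -/
noncomputable def zetaClamp (R : ℝ) (dist : X → Y → ℝ) : X → Y → ℝ :=
  fun x y => max 0 (min 1 (R - dist x y))

/-- The lattice difference quotient `(∂^η_x ζ)(b, y) = η⁻¹(ζ(b₊, y) − ζ(b₋, y))` along the η-bonds `b = ⟨src b, tgt b⟩` of
T_η (the derivative in the printed requirement *"|(∂^η_xζ^{(k)})(b,y)| ≤ 1"*). [cite: Balaban1982Higgs2, (2.44) p.566] -/
noncomputable def diffQuot (η : ℝ) (src tgt : B → X) (ζ : X → Y → ℝ) : B → Y → ℝ :=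
  fun b y => (ζ (tgt b) y - ζ (src b) y) / η

/-- `zetaClamp R` takes values in [0, 1]. KERNEL. [cite: Balaban1982Higgs2, (2.44) p.566] -/
theorem zetaClamp_mem_Icc (R : ℝ) (dist : X → Y → ℝ) (x : X) (y : Y) :
    zetaClamp R dist x y ∈ Set.Icc (0 : ℝ) 1 :=
  ⟨le_max_left _ _, max_le zero_le_one (min_le_left _ _)⟩

/-- **EXISTENCE OF THE CUT-OFF ζ^{(k)} OF (2.44)** p. 566: the three printed requirements *"|(∂^η_xζ^{(k)})(b,y)| ≤ 1,
supp ζ^{(k)}(·,y) ⊂ {x ∈ T_η : |x − y| < r(L^kε) − 2M} and ζ^{(k)}(x,y) = 1 if |x − y| ≤ ½r(L^kε)"* (`B2StepK.IsCutoff244`) are met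
by the clamp `ζ(x,y) = max(0, min(1, r − 2M − |x − y|))` with its own difference quotient along the η-bonds, provided
`r ≥ 4M + 2` (automatic once r(L^kε) = R(1 + log(L^kε)⁻¹)^r is large against the fixed M) and the distance to y changes by
at most η across an η-bond (`hLip`, true for the sup-distance (I.1.3) on T_η). KERNEL. [cite: Balaban1982Higgs2, (2.44) p.566] -/
theorem zetaClamp_isCutoff244 {η r M : ℝ} (hη : 0 < η) (dist : X → Y → ℝ) (src tgt : B → X)
    (hLip : ∀ b y, |dist (tgt b) y - dist (src b) y| ≤ η) (hr : 4 * M + 2 ≤ r) :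
    B2StepK.IsCutoff244 (zetaClamp (r - 2 * M) dist)
      (diffQuot η src tgt (zetaClamp (r - 2 * M) dist)) dist r M := by
  refine ⟨fun b y => ?_, fun x y hxy => ?_, fun x y hxy => ?_⟩
  · -- |∂^η ζ| ≤ 1: the clamp is 1-Lipschitz and the distance moves by ≤ η along a bond
    simp only [diffQuot, zetaClamp]
    rw [abs_div, abs_of_pos hη, div_le_one hη]
    refine (Literature.NumberTheory.LFunctions.PlateauMollifier.abs_clamp_sub_clamp_le _ _).trans ?_
    have : r - 2 * M - dist (tgt b) y - (r - 2 * M - dist (src b) y) = -(dist (tgt b) y - dist (src b) y) := by ring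
    rw [this, abs_neg]
    exact hLip b y
  · -- support: ζ ≠ 0 forces r − 2M − |x − y| > 0
    simp only [zetaClamp] at hxy
    by_contra hle
    rw [not_lt] at hle
    apply hxy
    apply max_eq_left
    exact min_le_of_right_le (by linarith)
  · -- ζ = 1 for |x − y| ≤ r/2, because then r − 2M − |x − y| ≥ r/2 − 2M ≥ 1
    simp only [zetaClamp]
    rw [min_eq_left (by linarith), max_eq_right zero_le_one]

end Cutoff

/-! ## §8 (v1.1) The error term of (2.47) from localized kernel bounds — p. 568 «We use Proposition I.2.1 and
restrictions on the fields, and we estimate unnecessary terms by O((L^{k−1}ε)^κ)|Λ₆^{(k−1)}|»; p. 580, after (2.109):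
«This remark holds for the other expressions of this type, e.g. for the expression connected with (2.47)»

v1.1 (unit `lit-balaban-r14` gen 4, 2026-08-21; APPEND-ONLY, the v1 declarations above are byte-identical).  The three
replacement costs `e₁, e₂, e₃` of `eq247_of_replacements` are bilinear forms `⟨u, (Δ′ − Δ)w⟩` (or `⟨u, Δw⟩` between far
apart supports) in the masked fields.  The printed mechanism, KERNEL-PROVED here in schematic coordinates: the kernel of
the operator difference obeys a LOCALIZED bound of the (I.2.29)/(2.109) type — its row sums from a point `x` are
`≦ c·e^{−δ·d(x)}·G` with `d(x)` ↤ the distance from x to the region where the two operators differ (resp. to the support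
of the other field) and `G` ↤ the lattice sum `Σ_{x′}e^{−δ₀|x−x′|}` (`abs_bilin_le_of_rowBound`); the test field is
supported where `d ≧ r(ℓ)` and the fields are bounded by the restrictions, `|u|, |w| ≦ Φ` (*"restrictions on the
fields"*); the lattice sum `Σ_x e^{−(δ/2)d(x)}` is `≦ V` ↤ O(1)|Λ₆^{(k−1)}| (`sum_localized_le`).  Then each cost is
`≦ Φ²·cG·e^{−(δ/2)r(ℓ)}·V` (`replacement_cost_le`), and with the rough field bound `Φ ≦ C_Φℓ⁻²` (cf. (3.16)) and
`r(ℓ) = R(1 + log ℓ⁻¹)^r` the factor `e^{−(δ/2)r(ℓ)}ℓ⁻⁴` is `≦ C_κℓ^κ` for every κ (`B2StepK.rDecayBeatsPowers`), which turns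
`eq247_of_replacements` into (2.47) with its printed error `O(ℓ^κ)|Λ₆|` (`eq247_of_costs_pow`).  NOT modelled: the
identification of the four kernels with Prop. I.2.1/I.2.2 for the concrete operators Δ^{(k),L^kε}_{Λ₅}(B^{k−1}(·), A^{(k),ε}).
-/

section Eq247Kernel

variable {X : Type*} [Fintype X]

/-- `|⟨u, Hw⟩| ≦ Σ_x Σ_{x′} |u(x)|·|h(x,x′)|·|w(x′)|`. KERNEL. [cite: Balaban1982Higgs2, (2.47) p.568] -/
theorem abs_dotProduct_mulVec_le_sum (H : Matrix X X ℝ) (u w : X → ℝ) :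
    |u ⬝ᵥ H *ᵥ w| ≤ ∑ x, ∑ x', |u x| * |H x x'| * |w x'| := by
  unfold dotProduct Matrix.mulVec
  refine (Finset.abs_sum_le_sum_abs _ _).trans (Finset.sum_le_sum fun x _ => ?_)
  rw [abs_mul]
  unfold dotProduct
  calc |u x| * |∑ x', H x x' * w x'| ≤ |u x| * ∑ x', |H x x' * w x'| :=
        mul_le_mul_of_nonneg_left (Finset.abs_sum_le_sum_abs _ _) (abs_nonneg _)
    _ = ∑ x', |u x| * |H x x'| * |w x'| := by
        rw [Finset.mul_sum]
        refine Finset.sum_congr rfl fun x' _ => ?_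
        rw [abs_mul]; ring

/-- **The localized form bound**: if the test field `u` is supported in `S` with `|u| ≦ U`, `|w| ≦ W`, and the row sums
of `|h(x,·)|` from the points `x ∈ S` are `≦ a(x)`, then `|⟨u, Hw⟩| ≦ U·W·Σ_{x∈S} a(x)`. KERNEL.
[cite: Balaban1982Higgs2, (2.47) p.568, (2.109) p.580] -/
theorem abs_bilin_le_of_rowBound {H : Matrix X X ℝ} {u w : X → ℝ} {S : Finset X} {U W : ℝ} {a : X → ℝ}
    (hU : 0 ≤ U) (hW : 0 ≤ W) (hu : ∀ x, |u x| ≤ U) (hsupp : ∀ x, x ∉ S → u x = 0) (hw : ∀ x, |w x| ≤ W)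
    (hrow : ∀ x ∈ S, ∑ x', |H x x'| ≤ a x) :
    |u ⬝ᵥ H *ᵥ w| ≤ U * W * ∑ x ∈ S, a x := by
  classical
  refine (abs_dotProduct_mulVec_le_sum H u w).trans ?_
  have hpt : ∀ x, ∑ x', |u x| * |H x x'| * |w x'| ≤ U * W * (if x ∈ S then a x else 0) := by
    intro x
    by_cases hx : x ∈ S
    · rw [if_pos hx]
      calc ∑ x', |u x| * |H x x'| * |w x'| ≤ ∑ x', U * |H x x'| * W :=
            Finset.sum_le_sum fun x' _ =>
              mul_le_mul (mul_le_mul_of_nonneg_right (hu x) (abs_nonneg _)) (hw x') (abs_nonneg _)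
                (mul_nonneg hU (abs_nonneg _))
        _ = U * W * ∑ x', |H x x'| := by rw [Finset.mul_sum]; exact Finset.sum_congr rfl fun x' _ => by ring
        _ ≤ U * W * a x := mul_le_mul_of_nonneg_left (hrow x hx) (mul_nonneg hU hW)
    · rw [if_neg hx, hsupp x hx]
      simp
  calc ∑ x, ∑ x', |u x| * |H x x'| * |w x'| ≤ ∑ x, U * W * (if x ∈ S then a x else 0) :=
        Finset.sum_le_sum fun x _ => hpt x
    _ = U * W * ∑ x ∈ S, a x := by
        rw [← Finset.mul_sum, Finset.sum_ite_mem, Finset.univ_inter]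

/-- **Exponential localization of a lattice sum**: if `d(x) ≧ r` on `S` and `Σ_x e^{−(δ/2)d(x)} ≦ V` (↤ O(1)·|region|), then
`Σ_{x∈S} c·e^{−δd(x)} ≦ c·e^{−(δ/2)r}·V`. KERNEL. [cite: Balaban1982Higgs2, (2.47) p.568, (2.109) p.580] -/
theorem sum_localized_le {S : Finset X} {c δ r V : ℝ} {d : X → ℝ} (hc : 0 ≤ c) (hδ : 0 ≤ δ)
    (hfar : ∀ x ∈ S, r ≤ d x) (hV : ∑ x, Real.exp (-(δ / 2 * d x)) ≤ V) :
    ∑ x ∈ S, c * Real.exp (-(δ * d x)) ≤ c * Real.exp (-(δ / 2 * r)) * V := by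
  have hpt : ∀ x ∈ S, c * Real.exp (-(δ * d x)) ≤ c * (Real.exp (-(δ / 2 * r)) * Real.exp (-(δ / 2 * d x))) := by
    intro x hx
    refine mul_le_mul_of_nonneg_left ?_ hc
    rw [← Real.exp_add]
    refine Real.exp_le_exp.2 ?_
    have : δ / 2 * r ≤ δ / 2 * d x := mul_le_mul_of_nonneg_left (hfar x hx) (by linarith)
    linarith
  calc ∑ x ∈ S, c * Real.exp (-(δ * d x))
      ≤ ∑ x ∈ S, c * (Real.exp (-(δ / 2 * r)) * Real.exp (-(δ / 2 * d x))) := Finset.sum_le_sum hpt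
    _ = c * Real.exp (-(δ / 2 * r)) * ∑ x ∈ S, Real.exp (-(δ / 2 * d x)) := by
        rw [Finset.mul_sum]; exact Finset.sum_congr rfl fun x _ => by ring
    _ ≤ c * Real.exp (-(δ / 2 * r)) * ∑ x, Real.exp (-(δ / 2 * d x)) :=
        mul_le_mul_of_nonneg_left
          (Finset.sum_le_univ_sum_of_nonneg fun x => (Real.exp_pos _).le) (by positivity)
    _ ≤ c * Real.exp (-(δ / 2 * r)) * V := mul_le_mul_of_nonneg_left hV (by positivity)

/-- **One replacement cost** (the mechanism of *"We use Proposition I.2.1 and restrictions on the fields"*): a bilinear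
form whose kernel has row sums `≦ c·e^{−δd(x)}·G` from the points of the support `S` of the test field `u` (a bound of
the type (I.2.29)/(2.109) summed over `x′` with `G` ↤ `Σ_{x′}e^{−δ₀|x−x′|}`), `d ≧ r` on `S`, `|u| ≦ U`, `|w| ≦ W`,
`Σ_x e^{−(δ/2)d(x)} ≦ V`, is bounded by `U·W·cG·e^{−(δ/2)r}·V`. KERNEL. [cite: Balaban1982Higgs2, (2.47) p.568, (2.109) p.580] -/
theorem replacement_cost_le {H : Matrix X X ℝ} {u w : X → ℝ} {S : Finset X} {U W c G δ r V : ℝ} {d : X → ℝ}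
    (hU : 0 ≤ U) (hW : 0 ≤ W) (hc : 0 ≤ c) (hG : 0 ≤ G) (hδ : 0 ≤ δ) (hu : ∀ x, |u x| ≤ U)
    (hsupp : ∀ x, x ∉ S → u x = 0) (hw : ∀ x, |w x| ≤ W)
    (hrow : ∀ x ∈ S, ∑ x', |H x x'| ≤ c * G * Real.exp (-(δ * d x))) (hfar : ∀ x ∈ S, r ≤ d x)
    (hV : ∑ x, Real.exp (-(δ / 2 * d x)) ≤ V) :
    |u ⬝ᵥ H *ᵥ w| ≤ U * W * (c * G * Real.exp (-(δ / 2 * r)) * V) := by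
  refine (abs_bilin_le_of_rowBound hU hW hu hsupp hw hrow).trans ?_
  exact mul_le_mul_of_nonneg_left (sum_localized_le (mul_nonneg hc hG) hδ hfar hV) (mul_nonneg hU hW)

/-- **The printed currency «O(ℓ^κ)», for every κ**: with `r = r(ℓ) = R(1 + log ℓ⁻¹)^r` (`B2.rFn`, δ, R > 0, r > 1) and
the rough field bounds `U, W ≦ C_Φℓ⁻²` (cf. (3.16) p. 586), for every κ there is `C_κ` (depending on δ, R, r, κ only)
with `U·W·e^{−(δ/2)r(ℓ)} ≦ C_Φ²·C_κ·ℓ^κ` on `0 < ℓ ≦ 1` — r14's `B2StepK.rDecayBeatsPowers` at exponent κ + 4.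
[cite: Balaban1982Higgs2, (2.47) p.568, (2.109) p.580] -/
theorem fieldSq_rDecay_le_pow {δ R r : ℝ} (hδ : 0 < δ) (hR : 0 < R) (hr : 1 < r) (κ : ℝ) :
    ∃ Cκ : ℝ, 0 ≤ Cκ ∧ ∀ (CΦ ℓ U W : ℝ), 0 ≤ CΦ → 0 < ℓ → ℓ ≤ 1 → 0 ≤ U → U ≤ CΦ / ℓ ^ 2 → 0 ≤ W →
      W ≤ CΦ / ℓ ^ 2 → U * W * Real.exp (-(δ / 2 * B2.rFn R r ℓ)) ≤ CΦ ^ 2 * Cκ * ℓ ^ κ := by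
  obtain ⟨C4, hC4⟩ := B2StepK.rDecayBeatsPowers (half_pos hδ) hR hr (κ + 4)
  have hC4pos : 0 ≤ C4 := by
    have h := hC4 1 one_pos le_rfl
    rw [Real.one_rpow, mul_one] at h
    exact (Real.exp_pos _).le.trans h
  refine ⟨C4, hC4pos, fun CΦ ℓ U W hCΦ hℓ hℓ1 hU0 hU hW0 hW => ?_⟩
  have hUW : U * W ≤ CΦ / ℓ ^ 2 * (CΦ / ℓ ^ 2) := mul_le_mul hU hW hW0 (by positivity)
  have hexp := hC4 ℓ hℓ hℓ1
  have hpow : ℓ ^ (κ + 4) = ℓ ^ κ * ℓ ^ 4 := by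
    rw [Real.rpow_add hℓ, show ((4 : ℝ)) = ((4 : ℕ) : ℝ) by norm_num, Real.rpow_natCast]
  calc U * W * Real.exp (-(δ / 2 * B2.rFn R r ℓ))
      ≤ CΦ / ℓ ^ 2 * (CΦ / ℓ ^ 2) * (C4 * ℓ ^ (κ + 4)) :=
        mul_le_mul hUW hexp (Real.exp_pos _).le (by positivity)
    _ = CΦ ^ 2 * C4 * ℓ ^ κ := by
        rw [hpow]; field_simp

/-- **(2.47) with its printed error from the replacement costs in the «O(ℓ^κ)» currency**: if the three replacement costs
of `eq247_of_replacements` satisfy `e₁ + e₂ + e₃ ≦ K·U·W·e^{−(δ/2)r(ℓ)}·vol6` (each a `replacement_cost_le`-bound with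
`V ≦ O(1)|Λ₆^{(k−1)}|`, the O(1)'s and the halves collected in `K`), the fields obey the rough bounds `U, W ≦ C_Φℓ⁻²`, and
`C_κ` is the constant of `fieldSq_rDecay_le_pow`, then (2.47) holds with the constant `K·C_Φ²·C_κ`:
`|total − (t1 + t2 + t3)| ≦ (K C_Φ² C_κ)·ℓ^κ·vol6`. KERNEL. [cite: Balaban1982Higgs2, (2.47) p.568] -/
theorem eq247_of_costs_pow {total t1 t2 t3 e₁ e₂ e₃ K U W CΦ Cκ δ R r ℓ κ vol6 : ℝ}
    (h : |total - (t1 + t2 + t3)| ≤ e₁ + e₂ + e₃)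
    (hsum : e₁ + e₂ + e₃ ≤ K * (U * W * Real.exp (-(δ / 2 * B2.rFn R r ℓ))) * vol6) (hK : 0 ≤ K)
    (hvol : 0 ≤ vol6) (hpow : U * W * Real.exp (-(δ / 2 * B2.rFn R r ℓ)) ≤ CΦ ^ 2 * Cκ * ℓ ^ κ) :
    Eq247 (K * CΦ ^ 2 * Cκ) ℓ κ vol6 total t1 t2 t3 := by
  unfold Eq247
  refine h.trans (hsum.trans ?_)
  calc K * (U * W * Real.exp (-(δ / 2 * B2.rFn R r ℓ))) * vol6 ≤ K * (CΦ ^ 2 * Cκ * ℓ ^ κ) * vol6 :=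
        mul_le_mul_of_nonneg_right (mul_le_mul_of_nonneg_left hpow hK) hvol
    _ = K * CΦ ^ 2 * Cκ * ℓ ^ κ * vol6 := by ring

end Eq247Kernel

end Literature.MathematicalPhysics.QuantumFieldTheory.Balaban1983to89.B2Sect2BDensities
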